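import Summits.BirchSwinnertonDyer.BirchSwinnertonDyer.Theorems.EisensteinPrimesAcTwistDeformationCurveStrictAtShapiro
import Summits.BirchSwinnertonDyer.BirchSwinnertonDyer.Theorems.EisensteinPrimesGrSelmerImprimitiveFiniteness
import HarnessLib

/-!
# The Shapiro descent identifies `S_{𝓛^{v̄}}(K, 𝐃)` with the STRICT `S₀`-imprimitive group `H¹_{𝓕_Gr^{S₀}}(K_∞, M) = grSelmer κ M v̄ S₀`
# for the one-variable twist deformation `𝐃 = bigRep κ ρ₀` of a GENERIC `p`-primary module, `T ↦ conj_γ − 1`; hence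
# `corank_Λ S_{𝓛^{v̄}}(K, 𝐃) = 0` from the cotorsion of ANY strict dual datum `𝔛^{S₀}_Gr`, and `𝔛^{S₀}_Gr` HAS NO NON-ZERO FINITE
# `Λ`-SUBMODULE — and NO `p`-TORSION when `μ = 0` — whenever `S_{𝓛^{v̄}}(K, 𝐃)` is almost divisible
# (cell `bsd-eis`, width seat `bsd-line-x2-p2` gen 27; crux 4 `BSDpOnCellC` stmt-BirchSwinnertonDyer-19034, line telescope v21 UNCHANGED;
# the GENERIC twin of x2-p2 g7's CURVE file `…AcTwistDeformationCurveStrictAtShapiro` (`selmerAc` / `XAc` ↦ `KellerYin2024.grSelmer` / `GrDualData`))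

WHY (C2 programme, part P3; evidence #59 on -19034, host conditions STATUS l.7341): the one place where crux 4's cone consumes the
DIMENSION clause of CGLS 2022 Prop. 1.2.5 (`ResidualDevissageNonsplitLambdaIdentityOfFacts.lambdaInvariant_le_add_of_prop125_of_cor126`) uses
it only to get «`𝔛^{Sf}_θ` has no `p`-torsion» for the two residual characters. CGLS prove that from «`𝔛_θ^S` has no non-zero finite
`Λ`-submodule» (Greenberg's almost-divisibility of the Selmer group of the twist deformation, their Prop. 1.2.5 proof citing [Gr5] Prop. 4.1.1)
and `μ = 0`. The tree already runs this road for the CURVE (`XAcImprimitiveNoPTorsionOfPoitouTateAt.xAc_smul_eq_zero_imp_ofPoitouTateAt`,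
h411-free, fed by Milne I 4.10 (a) at totally complex `K`); this file is the module-generic Shapiro half of the same road for the STRICT
Greenberg groups of ANY `p`-primary `M` with open stabilisers (in particular Keller–Yin's character modules `(F/𝒪)(θ)`), so that the
character instance (P3-b) is a composition with x2-p2 g18's GENERIC `bigRep_strictAtSelmer_isAlmostDivisible_of_dualBasis_ofPoitouTateAt`.

HONEST FRAMING (cell `bsd-eis`, run/shared/lean/pub/bsd-eis/): plumbing on constructed objects; no definition, no named fact, no `sorry`, no
`Theses` import; nothing about BSD or a main conjecture is asserted; nothing booked; no label or count moves (27 names by name of record); helper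
`--supports stmt-BirchSwinnertonDyer-19034`; closes no stub. UNCONDITIONAL (the almost-divisibility is an INPUT here).

## What

Data (generic twin of the curve file): `K` ANY number field (the strict Greenberg groups carry no archimedean condition, so the curve
file's `hKc` has no counterpart), `S ⊇ {w ∣ p}` (`hS`), `κ` a `ℤ_p`-extension, `A` a discrete
`p`-primary `ℤ_p`-module with a continuous `ℤ_p`-linear action `ρ₀` of `G_{K,S}`, `M` a discrete `Γ_K`-module with `ψ : A ≃+ M`,
`ψ (ρ₀ σ̄ a) = σ • ψ a` (so `M` is `p`-primary with open stabilisers: hypotheses `hM`, `hstab`), `v̄ ∈ S` above `p`, `S₀ ⊆ S` with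
`S ∩ {w ∤ p} ⊆ S₀` (`hSf₁`, `hSf₂`), `L` ANY specification with `L w = if w = v̄ then ⊥ else ⊤`, `F` ANY additive map with the Shapiro-descent
formula (LEAD g2's `exists_shapiroDescent`).

* §1 `shapiroDescent_mem_grSelmer_of_loc_eq_zero` (INTO: `loc_v̄[c] = 0 ⟹ F[c] ∈ grSelmer κ M v̄ S₀`; unramified outside `S₀ ∪ {w ∣ p}` because a
  class of `G_{K,S}` is unramified outside `S`; strict at `v̄` by LEAD g2's dictionary and `strictKer (strictDatum) = awayKer`; the relaxed datum at the
  other places above `p` imposes nothing), `exists_loc_eq_zero_and_shapiroDescent_eq_of_mem_grSelmer` (ONTO), **`exists_addMonoidHom_strictAtSelmer_grSelmer_bijective`**: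
  a BIJECTIVE additive `φ : S_L(K, 𝐃) → grSelmer κ M v̄ S₀` with `φ (T • s) = (conj_γ − 1)(φ s)`.
* §2 **`hasCorank_strictAtSelmer_zero_of_grDualData`** — `corank_Λ S_L(K, 𝐃) = 0` from ANY strict dual datum `D : GrDualData κ M v̄ S₀ γ` that is
  finitely generated and `Λ`-torsion (the dual pair `GrSelmerImprimitiveFiniteness.isDualPair_grDualData` surjects `Λ`-linearly onto
  `Hom(S_L, ℚ/ℤ)` along `φ`).
* §3 **`grDualData_hasNoPseudoNullSubmodule_of_isAlmostDivisible`**, **`grDualData_eq_bot_of_finite_of_isAlmostDivisible`**, and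
  **`grDualData_eq_zero_of_smul_eq_zero_of_isAlmostDivisible`**: if `S_L(K, 𝐃)` is almost `Λ`-divisible then `D.X` has no non-zero
  pseudo-null / finite `Λ`-submodule, and — with `D.X` f.g. torsion `μ = 0` — NO `p`-TORSION.

References: [Greenberg2006] Thm. 3 p. 342; [GreenbergVatsal2000] §2 pp. 15–17, 20; [KellerYin2024] §1.2, §1.4 (e); [GreenbergLNM1716] §1 p. 60;
[Greenberg2016Selmer] §1 p. 2 (almost divisible ⇔ no non-zero pseudo-null submodule in the dual); [Washington1997] §13.2;
[CastellaGrossiLeeSkinner2022] proof of Prop. 1.2.5 («𝔛_θ^S is a free ℤ_p-module»), Cor. 1.4.3.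
-/

set_option autoImplicit false
set_option linter.dupNamespace false -- the summit namespace `…BirchSwinnertonDyer.BirchSwinnertonDyer.Theorems` (Sub = Summit, D-0017) trips it

noncomputable section

open scoped Classical
open NumberField IsDedekindDomain Field PowerSeries
open Literature.NumberTheory.EllipticCurves Literature.NumberTheory.EllipticCurves.GreenbergSelmer
  Literature.NumberTheory.EllipticCurves.GreenbergVatsal2000 Literature.NumberTheory.GaloisRepresentations
  Literature.NumberTheory.EllipticCurves.IwasawaDual Literature.NumberTheory.EllipticCurves.KellerYin2024
  Literature.NumberTheory.IwasawaTheory Literature.NumberTheory.IwasawaTheory.Greenberg2016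
  Literature.NumberTheory.IwasawaTheory.Greenberg2006
  Summit.BirchSwinnertonDyer.BirchSwinnertonDyer.Theorems.GreenbergFullAtSelmer

namespace Summit.BirchSwinnertonDyer.BirchSwinnertonDyer.Theorems.AcTwistDeformation

section GrSelmerStrictAt

variable {K : Type} [Field K] [NumberField K] (S : Set (HeightOneSpectrum (𝓞 K))) {p : ℕ} [Fact p.Prime]
  {A : Type} [AddCommGroup A] [Module ℤ_[p] A] [TopologicalSpace A] [DiscreteTopology A]
  [TopologicalSpace (PowerSeries ℤ_[p])] [IsTopologicalRing (PowerSeries ℤ_[p])]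
  [IsTopologicalAddGroup (BigRepModule ℤ_[p] p A)]
  [ContinuousSMul (PowerSeries ℤ_[p]) (BigRepModule ℤ_[p] p A)]
  (hS : ∀ v : HeightOneSpectrum (𝓞 K), ((p : ℕ) : 𝓞 K) ∈ v.asIdeal → v ∈ S)
  (κ : ZpExtension K p)
  (ρ₀ : ContinuousRep (GaloisGroupUnramifiedOutside K S) ℤ_[p] A)
  (hA : ∀ a : A, ∃ k : ℕ, p ^ k • a = 0)
  {M : Type} [AddCommGroup M] [DistribMulAction (absoluteGaloisGroup K) M] [TopologicalSpace M]
  [DiscreteTopology M]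
  (ψ : A ≃+ M) (hψ : ∀ (σ : absoluteGaloisGroup K) (a : A), ψ (ρ₀ (toUnramifiedQuot K S σ) a) = σ • ψ a)
  (hM : ∀ m : M, ∃ k : ℕ, p ^ k • m = 0)
  (hstab : ∀ m : M, IsOpen (MulAction.stabilizer (absoluteGaloisGroup K) m : Set (absoluteGaloisGroup K)))
  {vbar : HeightOneSpectrum (𝓞 K)} (hvbar : ((p : ℕ) : 𝓞 K) ∈ vbar.asIdeal)
  (S₀ : Set (HeightOneSpectrum (𝓞 K))) (hSf₁ : S₀ ⊆ S)
  (hSf₂ : ∀ w ∈ S, ((p : ℕ) : 𝓞 K) ∉ w.asIdeal → w ∈ S₀)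
  {F : (bigRep (κ.liftUnramifiedOutside S hS) ρ₀).H 1 →+ subgroupH1 κ.kerSubgroup M}
  (hF : ∀ (c : contOneCocycles (bigRep (κ.liftUnramifiedOutside S hS) ρ₀).toTopRep)
    (z : contOneCocycles (discreteTopRep κ.kerSubgroup M)),
    (∀ h : κ.kerSubgroup, z.1 h = ψ ((c.1 (toUnramifiedQuot K S h) : BigRepModule ℤ_[p] p A) 0)) →
    F (oneCocycleClass _ c) = oneCocycleClass _ z)

/-! ## §1 INTO, ONTO, and the bijection -/

include hψ hA hSf₂ hF in
/-- **INTO**: if `loc_v̄[c] = 0` then `F[c] ∈ H¹_{𝓕_Gr^{S₀}}(K_∞, M) = grSelmer κ M v̄ S₀` — unramified at every `w ∉ S₀`, `w ∤ p`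
(such `w` lie outside `S`, and the descent of a class of `G_{K,S}` is unramified outside `S`:
`conjH1_shapiroDescent_mem_unramifiedKer_of_not_mem`), STRICT above `v̄` (LEAD g2's `loc = 0 ⟹ awayKer` and `strictKer (strictDatum) =
awayKer`), and NO condition above the other places over `p` (`strictKer (relaxedDatum) = ⊤`). The strict Greenberg group has no archimedean
and no «locally trivial at good places» clause, so (unlike the curve twin) nothing about `M` beyond `p`-primarity is used.
[cite: GreenbergVatsal2000, §2 pp. 15–17, 20 (arXiv:math/9906215)] [cite: Greenberg2006, Thm. 3 p. 342] [cite: KellerYin2024, §1.2 Def. (1)–(2) (arXiv:2402.12781v2)] -/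
theorem shapiroDescent_mem_grSelmer_of_loc_eq_zero
    (c : contOneCocycles (bigRep (κ.liftUnramifiedOutside S hS) ρ₀).toTopRep)
    (hloc : loc S (bigRep (κ.liftUnramifiedOutside S hS) ρ₀) (Sum.inr vbar) 1 (oneCocycleClass _ c) = 0) :
    F (oneCocycleClass _ c) ∈ grSelmer κ M vbar S₀ := by
  haveI : κ.kerSubgroup.Normal := by rw [ZpExtension.kerSubgroup]; infer_instance
  change F (oneCocycleClass _ c) ∈ datumStrictSelmerInfty κ M (Castella2018.AcSelmer.bdpData M p vbar) S₀
  rw [datumStrictSelmerInfty_eq, mem_datumStrictSelmer_iff, mem_unramifiedOutside_iff]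
  refine ⟨fun w hwS₀ hpw σ ↦ ?_, fun v hv σ ↦ ?_⟩
  · -- `w ∤ p`, `w ∉ S₀`, hence `w ∉ S`: unramified
    have hwS : w ∉ S := fun h ↦ hwS₀ (hSf₂ w h hpw)
    exact conjH1_shapiroDescent_mem_unramifiedKer_of_not_mem S hS κ ρ₀ ψ hψ hF hwS c σ
  · by_cases hv𝔭 : v = vbar
    · subst hv𝔭
      rw [Castella2018.AcSelmer.bdpData_self,
        Literature.NumberTheory.EllipticCurves.BigGaloisRep.strictKer_strictDatum_eq_awayKer]
      exact conjH1_shapiroDescent_mem_awayKer_of_loc_eq_zero S hS κ ρ₀ ψ hψ hA hF v c hloc σ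
    · rw [Castella2018.AcSelmer.bdpData_of_ne (M := M) p vbar hv hv𝔭,
        Castella2018.AcSelmer.strictKer_relaxedDatum_eq_top]
      exact AddSubgroup.mem_top _

include hψ hA hvbar hSf₁ hF in
/-- **ONTO**: every class of `grSelmer κ M v̄ S₀` is `F[c]` for a cocycle `c` with `loc_v̄[c] = 0` — it is unramified outside `S ⊇ S₀` off
`p`, so `…ShapiroOnto` produces `c` (`exists_shapiroDescent_eq_of_mem_unramifiedOutside`), and its conjugates die above `v̄` (the strict
condition, `strictKer (strictDatum) = awayKer`), so `loc_v̄[c] = 0` by the converse dictionary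
(`loc_eq_zero_of_forall_conjH1_shapiroDescent_mem_awayKer`). [cite: GreenbergVatsal2000, §2 pp. 15–17, 20 (arXiv:math/9906215)]
[cite: Greenberg2006, Thm. 3 p. 342] -/
theorem exists_loc_eq_zero_and_shapiroDescent_eq_of_mem_grSelmer
    (y : subgroupH1 κ.kerSubgroup M) (hy : y ∈ grSelmer κ M vbar S₀) :
    ∃ c : contOneCocycles (bigRep (κ.liftUnramifiedOutside S hS) ρ₀).toTopRep,
      loc S (bigRep (κ.liftUnramifiedOutside S hS) ρ₀) (Sum.inr vbar) 1 (oneCocycleClass _ c) = 0 ∧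
        F (oneCocycleClass _ c) = y := by
  haveI : κ.kerSubgroup.Normal := by rw [ZpExtension.kerSubgroup]; infer_instance
  have hy' := hy
  change y ∈ datumStrictSelmerInfty κ M (Castella2018.AcSelmer.bdpData M p vbar) S₀ at hy'
  rw [datumStrictSelmerInfty_eq, mem_datumStrictSelmer_iff, mem_unramifiedOutside_iff] at hy'
  -- unramified outside `S`
  have hunr : y ∈ GreenbergVatsal2000.unramifiedOutside κ.kerSubgroup M p S := by
    rw [GreenbergVatsal2000.mem_unramifiedOutside_iff]
    intro w hwS hpw σ
    exact hy'.1 w (fun h ↦ hwS (hSf₁ h)) hpw σ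
  obtain ⟨ξ, hξ⟩ := exists_shapiroDescent_eq_of_mem_unramifiedOutside S hS κ ρ₀ ψ hψ hA hF y hunr
  obtain ⟨c, rfl⟩ := oneCocycleClass_surjective _ ξ
  refine ⟨c, ?_, hξ⟩
  refine loc_eq_zero_of_forall_conjH1_shapiroDescent_mem_awayKer S hS κ ρ₀ ψ hψ hA hF vbar c fun σ ↦ ?_
  rw [hξ, ← Literature.NumberTheory.EllipticCurves.BigGaloisRep.strictKer_strictDatum_eq_awayKer,
    ← Castella2018.AcSelmer.bdpData_self (M := M) p vbar hvbar]
  exact hy'.2 vbar hvbar σ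

include hψ hA hvbar hSf₁ hSf₂ hF in
/-- **`S_{𝓛^{v̄}}(K, 𝐃) ≅ grSelmer κ M v̄ S₀` as abelian groups, `T ↦ conj_γ − 1`.** For ANY specification `L` with
`L w = if w = v̄ then ⊥ else ⊤` there is a BIJECTIVE additive `φ : S_L(K, 𝐃) → grSelmer κ M v̄ S₀`, `φ s = F s`, with
`φ (T • s) = (conjGr γ − 1)(φ s)` (LEAD g2's orientation `shapiroDescent_X_smul`): injective by
`oneCocycleClass_eq_zero_of_shapiroDescent_eq_zero`, onto and into by §1, membership `c ∈ S_L ↔ loc_v̄ c = 0` (`mem_selmer_strictAt_iff`).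
Generic twin of `exists_addMonoidHom_strictAtSelmer_bijective` (curve). [cite: Greenberg2006, Thm. 3 p. 342 ("as `Λ`-modules")] [cite: GreenbergVatsal2000, §2 p. 17] -/
theorem exists_addMonoidHom_strictAtSelmer_grSelmer_bijective {γ : absoluteGaloisGroup K} [hγ : Fact (κ.IsTopGenerator γ)]
    (L : Specification S (bigRep (κ.liftUnramifiedOutside S hS) ρ₀))
    (hL : ∀ w : Place K, L w = if w = Sum.inr vbar then ⊥ else ⊤) :
    ∃ φ : L.selmer →+ grSelmer κ M vbar S₀, Function.Bijective φ ∧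
      (∀ s : L.selmer, ((φ s : grSelmer κ M vbar S₀) : subgroupH1 κ.kerSubgroup M) =
        F (s : (bigRep (κ.liftUnramifiedOutside S hS) ρ₀).H 1)) ∧
      ∀ s : L.selmer, φ (DistribSMul.toAddMonoidHom L.selmer (PowerSeries.X : PowerSeries ℤ_[p]) s) =
        (conjGr κ M vbar S₀ γ - 1) (φ s) := by
  have hvS : vbar ∈ S := hS vbar hvbar
  -- INTO
  have hmem : ∀ s : L.selmer, F (s : (bigRep (κ.liftUnramifiedOutside S hS) ρ₀).H 1) ∈ grSelmer κ M vbar S₀ := by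
    rintro ⟨ξ, hξ⟩
    obtain ⟨c, rfl⟩ := oneCocycleClass_surjective _ ξ
    exact shapiroDescent_mem_grSelmer_of_loc_eq_zero S hS κ ρ₀ hA ψ hψ S₀ hSf₂ hF c
      ((mem_selmer_strictAt_iff L hL hvS _).1 hξ)
  let φ : L.selmer →+ grSelmer κ M vbar S₀ :=
    { toFun := fun s ↦ ⟨F s, hmem s⟩
      map_zero' := Subtype.ext (by simp)
      map_add' := fun s t ↦ Subtype.ext (by simp) }
  refine ⟨φ, ⟨?_, ?_⟩, fun s ↦ rfl, fun s ↦ ?_⟩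
  · -- injective
    refine (injective_iff_map_eq_zero φ).2 fun s hs ↦ ?_
    have h0 : F (s : (bigRep (κ.liftUnramifiedOutside S hS) ρ₀).H 1) = 0 := congrArg Subtype.val hs
    obtain ⟨c, hc⟩ := oneCocycleClass_surjective _ (s : (bigRep (κ.liftUnramifiedOutside S hS) ρ₀).H 1)
    rw [← hc] at h0
    exact Subtype.ext (hc.symm.trans
      (oneCocycleClass_eq_zero_of_shapiroDescent_eq_zero S hS κ ρ₀ ψ hψ hA hF c h0))
  · -- surjective
    rintro ⟨y, hy⟩
    obtain ⟨c, hloc, hcy⟩ := exists_loc_eq_zero_and_shapiroDescent_eq_of_mem_grSelmer S hS κ ρ₀ hA ψ hψ hvbar S₀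
      hSf₁ hF y hy
    exact ⟨⟨oneCocycleClass _ c, (mem_selmer_strictAt_iff L hL hvS _).2 hloc⟩, Subtype.ext hcy⟩
  · -- the orientation
    apply Subtype.ext
    change F ((PowerSeries.X : PowerSeries ℤ_[p]) • (s : (bigRep (κ.liftUnramifiedOutside S hS) ρ₀).H 1)) =
      conjH1 κ.kerSubgroup M γ (F s) - F s
    exact shapiroDescent_X_smul S hS κ ρ₀ ψ hψ hF hγ.out _

/-! ## §2 `corank_Λ S_{𝓛^{v̄}}(K, 𝐃) = 0` from the cotorsion of a strict dual datum -/

include hψ hA hM hstab hvbar hSf₁ hSf₂ hF in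
/-- **`corank_Λ S_L(K, 𝐃) = 0` FROM THE `Λ`-COTORSION OF ANY STRICT DUAL DATUM `D : GrDualData κ M v̄ S₀ γ`** (finitely generated and
torsion): along the injective `φ` of §1 the dual pair of `D` (`GrSelmerImprimitiveFiniteness.isDualPair_grDualData`) surjects `Λ`-linearly
onto `Hom(S_L, ℚ/ℤ)` (`IwasawaDual.IsDualPair.exists_linearMap_comp_surjective`), so every Pontryagin dual of `S_L` is finitely generated
torsion. Generic twin of `hasCorank_strictAtSelmer_zero_of_xAc`; the input `hSel` of
`bigRep_strictAtSelmer_isAlmostDivisible_of_dualBasis_ofPoitouTateAt`. [cite: Greenberg2006, Thm. 3 p. 342] [cite: GreenbergLNM1716, §1 p. 60] -/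
theorem hasCorank_strictAtSelmer_zero_of_grDualData {γ : absoluteGaloisGroup K} [hγ : Fact (κ.IsTopGenerator γ)]
    (L : Specification S (bigRep (κ.liftUnramifiedOutside S hS) ρ₀))
    (hL : ∀ w : Place K, L w = if w = Sum.inr vbar then ⊥ else ⊤)
    (D : GrDualData κ M vbar S₀ γ)
    (hXfin : Module.Finite (IwasawaAlgebra p) D.X) (hXtor : Module.IsTorsion (IwasawaAlgebra p) D.X) :
    HasCorank (PowerSeries ℤ_[p]) L.selmer 0 := by
  obtain ⟨φ, hφbij, -, hφ⟩ := exists_addMonoidHom_strictAtSelmer_grSelmer_bijective S hS κ ρ₀ hA ψ hψ hvbar S₀ hSf₁ hSf₂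
    hF (γ := γ) L hL
  have h := GrSelmerImprimitiveFiniteness.isDualPair_grDualData κ vbar hM hstab hγ.out S₀ D
  have h' := isDualPair_characterModule_selmer S hS κ ρ₀ L
  obtain ⟨G, hGsurj, -⟩ := h.exists_linearMap_comp_surjective h' φ hφ hφbij.1
  haveI : Module.Finite (PowerSeries ℤ_[p]) D.X := hXfin
  have htor : Module.IsTorsion (PowerSeries ℤ_[p]) (CharacterModule L.selmer) := fun x ↦ by
    obtain ⟨y, rfl⟩ := hGsurj x
    obtain ⟨a, ha⟩ := @hXtor y
    refine ⟨a, ?_⟩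
    rw [Submonoid.smul_def] at ha ⊢
    rw [← map_smul, ha, map_zero]
  intro Y _ _ toDual hY
  let e := hY.linearEquiv (isDualPairing_characterModule (PowerSeries ℤ_[p]) L.selmer)
  haveI : Module.Finite (PowerSeries ℤ_[p]) (CharacterModule L.selmer) := Module.Finite.of_surjective G hGsurj
  haveI : Module.Finite (PowerSeries ℤ_[p]) Y := Module.Finite.equiv e.symm
  refine (Module.finrank_eq_zero_iff_isTorsion (R := PowerSeries ℤ_[p]) (M := Y)).mpr fun y ↦ ?_
  obtain ⟨a, ha⟩ := @htor (e y)
  refine ⟨a, e.injective ?_⟩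
  rw [Submonoid.smul_def] at ha ⊢
  rw [map_smul, ha, map_zero]

/-! ## §3 `𝔛^{S₀}_Gr` has no non-zero finite `Λ`-submodule, and no `p`-torsion, when `S_{𝓛^{v̄}}(K, 𝐃)` is almost divisible -/

include hψ hA hM hstab hvbar hSf₁ hSf₂ hF in
/-- **A strict dual datum `D` IS A BALANCED PONTRYAGIN DUAL OF `S_L(K, 𝐃)` ⟹ no non-zero pseudo-null submodule when `S_L` is almost
divisible.** The `Λ`-linear `G : D.X → CharacterModule S_L`, `toDual ∘ φ`, is onto (`φ` injective) and injective (`φ` onto), hence a Greenberg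
dual pairing `IsDualPairing Λ S_L G`; `IsAlmostDivisible Λ S_L` then says every pseudo-null `Λ`-submodule of `D.X` is `⊥`. Generic twin of
`xAc_hasNoPseudoNullSubmodule_of_isAlmostDivisible`. [cite: Greenberg2016Selmer, §1 p. 2 L17–35 (almost divisible ⇔ no non-zero pseudo-null submodule)]
[cite: GreenbergLNM1716, §1 p. 60] -/
theorem grDualData_hasNoPseudoNullSubmodule_of_isAlmostDivisible {γ : absoluteGaloisGroup K}
    [hγ : Fact (κ.IsTopGenerator γ)]
    (L : Specification S (bigRep (κ.liftUnramifiedOutside S hS) ρ₀))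
    (hL : ∀ w : Place K, L w = if w = Sum.inr vbar then ⊥ else ⊤)
    (hAD : IsAlmostDivisible (PowerSeries ℤ_[p]) L.selmer) (D : GrDualData κ M vbar S₀ γ) :
    HasNoPseudoNullSubmodule (PowerSeries ℤ_[p]) D.X := by
  obtain ⟨φ, hφbij, -, hφ⟩ := exists_addMonoidHom_strictAtSelmer_grSelmer_bijective S hS κ ρ₀ hA ψ hψ hvbar S₀ hSf₁ hSf₂
    hF (γ := γ) L hL
  have h := GrSelmerImprimitiveFiniteness.isDualPair_grDualData κ vbar hM hstab hγ.out S₀ D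
  have h' := isDualPair_characterModule_selmer S hS κ ρ₀ L
  obtain ⟨G, hGsurj, hG⟩ := h.exists_linearMap_comp_surjective h' φ hφ hφbij.1
  have hGinj : Function.Injective G := h.injective_of_toDual_comp φ hφbij.2 hG
  have hpair : IsDualPairing (PowerSeries ℤ_[p]) L.selmer
      (G.toAddMonoidHom : D.X →+ (L.selmer →+ AddCircle (1 : ℚ))) :=
    { bijective := ⟨hGinj, hGsurj⟩
      map_smul := fun r x s ↦ by
        change G (r • x) s = G x (r • s)
        rw [map_smul]
        exact (isDualPairing_characterModule (PowerSeries ℤ_[p]) L.selmer).map_smul r (G x) s }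
  exact hAD D.X G.toAddMonoidHom hpair

include hψ hA hM hstab hvbar hSf₁ hSf₂ hF in
/-- **Every FINITE `Λ`-submodule of a strict dual datum `D.X` is `⊥`** when `S_L(K, 𝐃)` is almost divisible (finite ⟹ pseudo-null
over `Λ = ℤ_p⟦T⟧`, `isPseudoNull_of_finite`). «`𝔛_θ^S` has no non-zero finite `Λ`-submodule» (CGLS, proof of Prop. 1.2.5: «is a free
`ℤ_p`-module») at the generic-module level. [cite: CastellaGrossiLeeSkinner2022, proof of Prop. 1.2.5 and Cor. 1.4.3 (arXiv:2008.02571)]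
[cite: KellerYin2024, §1.4 (e) (arXiv:2402.12781v2 TeX L1162–1181)] [cite: NeukirchSchmidtWingberg2008, Ch. V §1 (5.1.4) Remark 4] -/
theorem grDualData_eq_bot_of_finite_of_isAlmostDivisible {γ : absoluteGaloisGroup K} [hγ : Fact (κ.IsTopGenerator γ)]
    (L : Specification S (bigRep (κ.liftUnramifiedOutside S hS) ρ₀))
    (hL : ∀ w : Place K, L w = if w = Sum.inr vbar then ⊥ else ⊤)
    (hAD : IsAlmostDivisible (PowerSeries ℤ_[p]) L.selmer) (D : GrDualData κ M vbar S₀ γ)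
    (N : Submodule (IwasawaAlgebra p) D.X) (hN : Finite N) : N = ⊥ :=
  grDualData_hasNoPseudoNullSubmodule_of_isAlmostDivisible S hS κ ρ₀ hA ψ hψ hM hstab hvbar S₀ hSf₁ hSf₂ hF L hL hAD D N
    (Literature.NumberTheory.EllipticCurves.isPseudoNull_of_finite p N)

include hψ hA hM hstab hvbar hSf₁ hSf₂ hF in
/-- **A strict dual datum `D.X` HAS NO `p`-TORSION** when it is finitely generated, `Λ`-torsion with `μ = 0` and `S_L(K, 𝐃)` is almost
divisible: `μ = 0` makes `D.X` finitely generated over `ℤ_p`, so its `p`-torsion is a finite `Λ`-submodule, hence `⊥`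
(`eq_zero_of_C_p_smul_eq_zero_of_muInvariant_eq_zero`). The hypothesis `∀ x, p • x = 0 → x = 0` that
`ResidualDevissageNonsplitLambdaIdentity.lambdaInvariant_le_add_of_grDualData_of_cor126` takes for the two character duals, at the
generic-module level. [cite: Washington1997, §13.2] [cite: CastellaGrossiLeeSkinner2022, proof of Prop. 1.2.5 («𝔛_θ^S is a free ℤ_p-module»), Cor. 1.4.3]
[cite: KellerYin2024, §1.4 (e) (arXiv:2402.12781v2 TeX L1162–1181)] -/
theorem grDualData_eq_zero_of_smul_eq_zero_of_isAlmostDivisible {γ : absoluteGaloisGroup K}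
    [hγ : Fact (κ.IsTopGenerator γ)]
    (L : Specification S (bigRep (κ.liftUnramifiedOutside S hS) ρ₀))
    (hL : ∀ w : Place K, L w = if w = Sum.inr vbar then ⊥ else ⊤)
    (hAD : IsAlmostDivisible (PowerSeries ℤ_[p]) L.selmer) (D : GrDualData κ M vbar S₀ γ)
    (hXfin : Module.Finite (IwasawaAlgebra p) D.X) (hXtor : Module.IsTorsion (IwasawaAlgebra p) D.X)
    (hμ : muInvariant p D.X = 0) (x : D.X) (hx : p • x = 0) : x = 0 := by
  letI : Module ℤ_[p] D.X := Module.compHom _ (algebraMap ℤ_[p] (IwasawaAlgebra p))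
  haveI : IsScalarTower ℤ_[p] (IwasawaAlgebra p) D.X := IsScalarTower.of_compHom ℤ_[p] _ _
  haveI := hXfin
  refine IwasawaAlgebra.eq_zero_of_C_p_smul_eq_zero_of_muInvariant_eq_zero (p := p) (M := D.X) hXtor
    (fun N hN ↦ grDualData_eq_bot_of_finite_of_isAlmostDivisible S hS κ ρ₀ hA ψ hψ hM hstab hvbar S₀ hSf₁ hSf₂ hF L hL
      hAD D N hN) hμ ?_
  rw [map_natCast, Nat.cast_smul_eq_nsmul]
  exact hx

end GrSelmerStrictAt

end Summit.BirchSwinnertonDyer.BirchSwinnertonDyer.Theorems.AcTwistDeformation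

end
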